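import Literature.Computability.Cryptography.ChenQuantumLWEReadoutBound

/-!
# Chen 2024 (withdrawn), Step 8 → Step 9: the ORDER of the read-out probability of the Step-9 datum

REPRODUCTION / ANALYSIS OF A CLAIMED RESULT UNDER ADJUDICATION — header required by the tree's literature
rule.  Author: Yilei Chen.  Title: *Quantum Algorithms for Lattice Problems*.  Venue: IACR Cryptology ePrint
Archive, Paper 2024/555, version of 18 April 2024 (the main claim WITHDRAWN by the author, title-page note;
the bug is in Step 9, p. 37). [ChenQuantumLattice2024]  Printed page numbers.

HONEST FRAMING (bundle `papers/QuantumAdvantage/lwe-quantum-autopsy/`, Part 1, generation 11): the value of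
this file is a set of kernel-checked THEOREMS — a two-sided quantitative statement (an explicit achievable
value and an upper bound of the same order) about one step of a withdrawn algorithm — NOT summit progress
and no cryptanalytic claim in either direction (nothing here says LWE is quantumly easy or hard; no algorithm
is proposed, repaired or broken).

THE QUESTION.  Module (R) `ChenQuantumLWEReadoutBound` (`Shape.step9Needs_readout_le`) proved: for every
POVM `E` on the Step-8 register `|φ7.d⟩` (module (O) `POVM`) and every classical decoder `dec` to
`ℤ_{D²P}`, some admissible instance of the class "slope unknown at ONE tail coordinate" has success weight
for the Step-9 datum `step9Needs = v′₀ mod D²P` (`ChenQuantumLWESteps`) at most `pairsCount(Q)/Q²·⟨φ7.d|φ7.d⟩`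
(`(2Q−1)/Q²` for prime `Q`), and left the ORDER open ((R) SCOPE (a): no achievability, one dummy only).
This file settles the order, for one copy of the state and the class of instances consistent with the
public data: the worst-case success weight of the best measurement lies between `(1/Q)·⟨φ7.d|φ7.d⟩`
(ACHIEVED, by blind guessing, on every instance) and `(1/Q + (1 − 1/Q)·((Q − φ(Q))/Q)^{r})·⟨φ7.d|φ7.d⟩`
with `r` the number of unknown tail slopes (`(1 − 1/Q)/Q^{r}` above chance for prime `Q`): blind
guessing of the one missing residue `v′₀ mod Q` is optimal up to a term decaying geometrically in `r`.

WHAT IS DONE HERE.  Fix an admissible shape `S`, a finite set `T` of tail coordinates whose slopes are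
unknown (`U ⊇ T+1`), ANY finite outcome type `κ`, ANY POVM `E` on `ℂ[ℤ_M^{n+1}]` and ANY decoder
`dec : κ → ℤ_{D²P}`; `φ` is Euler's totient.
* **`Shape.blindGuess_weight_eq`**, **`Shape.blindGuess_weight_eq_inst`** (LOWER side, exact): the POVM
  "computational read-out of the head coordinate `w₀`, then an independent uniform coin `c ∈ ℤ_Q`"
  (`POVM.readout`, `POVM.withCoin`) with the decoder `blindDec (w₀, c) = D·w₀ + D²p₁·c (mod D²P)` has
  success weight EXACTLY `(1/Q)·⟨φ7.d|φ7.d⟩` on EVERY admissible instance: on the support of `|φ7.d⟩`,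
  `w₀ ≡ v′₀/D (mod Dp₁)` (Claim 3.14, (N) `head_residue_of_pred8`), so exactly one of the `Q` coin values
  is right (`blindDec_correct_iff`).
* **`Shape.step9Needs_readout_le_dummies`** (UPPER side, sharp form): some instance `(b₂, v₂)` of the class
  `InClass U` has success weight `≤ (pairsCountT(Q,T)/Q^{2n})·⟨φ7.d|φ7.d⟩`, where
  `pairsCountT(Q,T) = #{(η, δ) ∈ ℤ_Qⁿ × ℤ_Qⁿ : Σ_{t∈T} η_t δ_t = 0}` counts pairs of vectors ORTHOGONAL ON
  `T` (`pairsCountT`, `kerCountT`).  Evaluations: `Q²·pairsCountT(Q,{t₁}) = Q^{2n}·pairsCount(Q)`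
  (`sq_mul_pairsCountT_singleton`, `pairsCountT_singleton_div`: for `T = {t₁}` the bound IS (R)'s
  `pairsCount(Q)/Q²`, nothing lost); `Q·pairsCountT ≤ Qⁿ(Qⁿ + (Q−1)·nonGenericCount)` with
  `nonGenericCount = #{η : no η_t, t ∈ T, a unit} = (Q − φ(Q))^{#T}·Q^{n−#T}` (`mul_pairsCountT_le`,
  `nonGenericCount_eq`, `nonGenericCount_prime`), whence
  **`Shape.step9Needs_readout_le_dummies'`**: `≤ (1/Q + (1 − 1/Q)·((Q − φ(Q))/Q)^{#T})·⟨φ7.d|φ7.d⟩`,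
  **`Shape.step9Needs_readout_le_dummies_prime`**: `≤ (1/Q + (1 − 1/Q)/Q^{#T})·⟨φ7.d|φ7.d⟩` (prime `Q`),
  **`Shape.step9Needs_readout_le_all`** (`T = U =` everything: the class of ALL admissible instances with
  the public data): `≤ (1/Q + (1 − 1/Q)·((Q − φ(Q))/Q)ⁿ)·⟨φ7.d|φ7.d⟩`.
* **`Shape.step9Needs_readout_order`**: the two sides in one statement.
* **`Shape.step9Needs_not_almostCertain_of_lt_order`** (`E` valued in `ℤ_{D²P}` itself): for every
  `ε < 1 − (1/Q + (1 − 1/Q)·((Q − φ(Q))/Q)ⁿ)` it is NOT the case that `step9Needs` is `ε`-almost certain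
  ((P) `POVM.AlmostCertain`) on `|φ7.d⟩` of every admissible instance — (R)'s `ε < 1 − pairsCount(Q)/Q²`
  (`> 1/3`) improved to every `ε` below `1 − 1/Q − (1 − 1/Q)((Q−φ(Q))/Q)ⁿ` (`→ 1 − 1/Q` geometrically in `n`).

THE ARGUMENT (kernel-checked throughout; the analytic engine is (R)'s, imported, not re-proved).  Average
over the `Q^{2n+1}` instances `(famBT β, v′ + L·(x, ȳ))`, `β ∈ ℤ_Qⁿ` (dummy slopes `2p₁β_t` added at the
coordinates `t+1`, `t ∈ T`; coordinates of `β` off `T` are ignored — harmless redundancy), `x ∈ ℤ_Q` the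
head offset, `ȳ ∈ ℤ_Qⁿ` the tail offsets (`inClass_famT`, `sig_BfamT`: `σ_{BfamT β}(η) = σ₀(η) + Σ_{t∈T} η_t β_t`).
(R)'s sandwich `sum_weight_fam_eq` (partial Fourier transform in `ȳ`, Step 8 as one norm-scaling map,
`x`-phases unimodular) applies verbatim with the slopes `BfamT β`; in block `η` the `Q` head offsets with a
common `m = −2(x + σ₀(η) + Σ_{t∈T} η_t β_t)` present the same vector and need `Q` different answers
((R) `POVM.sum_sum_filter_weight_re_le`, `label_inj`), and `β ↦ m` has fibres that are translates of the
kernel `{δ : Σ_{t∈T} η_t δ_t = 0}` (`card_fibre_le_kerCountT`, `Q` odd), of size `kerCountT(η) ≤ Q^{n−1}`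
as soon as some `η_t`, `t ∈ T`, is a unit (`kerCountT_le_of_isUnit`: `δ_t` is determined by the other
coordinates) and `≤ Qⁿ` always.  Summing, the total success weight over the family is at most
`Q·pairsCountT·n₀`, `n₀ = ⟨φ7.d|φ7.d⟩ = (MD)^{n+1}P2ⁿ` ((P) `star_phi7d_dotProduct_phi7d_inst`), against
`Q^{2n+1}` members: pigeonhole.

SCOPE (honest).  (a) What is and is not decided: the optimal worst-case (over the class) single-copy
success weight `OPT` for outputting `step9Needs` from `|φ7.d⟩` satisfies
`1/Q ≤ OPT/⟨φ7.d|φ7.d⟩ ≤ 1/Q + (1 − 1/Q)·((Q − φ(Q))/Q)^{r}` (`r` unknown slopes; both sides theorems here);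
the EXACT value of `OPT` (conceivably `pairsCountT/Q^{2n}` itself, attained on the family average by a
frame measurement) is NOT formalised and not claimed, nor is the exact evaluation of `pairsCountT` for
`#T ≥ 2`.  (b) The upper bound is on the AVERAGE over an explicit finite family inside the class, hence on
the worst case; the family is a proof device, no distribution on instances is part of the algorithm, and
nothing is asserted about any single named instance; the lower side holds on EVERY admissible instance.
(c) As in (O)–(R) the statements concern the Step-8 register state `|φ7.d⟩` of eq. (35)/§3.5.8 as formalised
in `ChenQuantumLWESteps` / `ChenQuantumLWEStepEight`, one run, one copy, and the class `Shape.InClass`;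
joint measurements on several runs and other algorithms for LWE are out of scope.  (d) Relation to Part 2
of the bundle: `ChenQuantumLWEDatumPrivacy` (T10, `datum_success_prob_le`, `Shape.datum_privacy`) proves a
bound of the same shape `1/Q + (1 − 1/Q)·π_B` (`π_B = Q^{−#U}` for prime `Q`) for guessing the residue
`a ∈ ℤ_Q` from the STEP-9 register `QFT|φ8.b⟩` averaged over class and secret shifts, with sharpness as a
by-hand remark; here the register is Step 8's `|φ7.d⟩`, the target is the full datum in `ℤ_{D²P}` through
an arbitrary decoder, the achievability is a theorem, and the two formal statements do not imply each
other (different states, different families).  (e) No numerics enter any proof.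

Everything is `sorry`-free over Mathlib and modules (A)–(R) of the bundle (imported, nothing re-proved).
-/

namespace Literature.Computability.Cryptography.Chen2024

open scoped BigOperators ComplexOrder
open Matrix

/-! ### Measurements with a coin; read-out weights -/

namespace POVM

variable {X κ : Type*} [Fintype X] [DecidableEq X] [Fintype κ] (E : POVM X κ)

/-- A measurement followed by an independent uniform coin on a finite nonempty type `C`: outcome `(k, c)`
has effect `E_k / #C`. [cite: NielsenChuang2010, §2.2.6 p. 90] -/
noncomputable def withCoin (C : Type*) [Fintype C] [Nonempty C] : POVM X (κ × C) where
  effect kc := (((Fintype.card C : ℝ)⁻¹ : ℝ) : ℂ) • E.effect kc.1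
  posSemidef kc := (E.posSemidef kc.1).smul
    (Complex.zero_le_real.2 (inv_nonneg.2 (Nat.cast_nonneg _)))
  sum_eq_one := by
    rw [Fintype.sum_prod_type]
    simp only [Finset.sum_const, Finset.card_univ]
    have hC : (Fintype.card C : ℂ) ≠ 0 := by exact_mod_cast Fintype.card_ne_zero
    calc ∑ k : κ, Fintype.card C • ((((Fintype.card C : ℝ)⁻¹ : ℝ) : ℂ) • E.effect k)
        = ∑ k : κ, E.effect k := by
          refine Finset.sum_congr rfl fun k _ => ?_
          rw [← Nat.cast_smul_eq_nsmul ℂ, smul_smul]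
          have : (Fintype.card C : ℂ) * (((Fintype.card C : ℝ)⁻¹ : ℝ) : ℂ) = 1 := by
            push_cast
            exact mul_inv_cancel₀ hC
          rw [this, one_smul]
      _ = 1 := E.sum_eq_one

/-- Weight of `(k, c)` under `E` + coin: `⟨ψ|E_k|ψ⟩ / #C`. [cite: NielsenChuang2010, §2.2.6 p. 90] -/
theorem withCoin_weight (C : Type*) [Fintype C] [Nonempty C] (ψ : X → ℂ) (k : κ) (c : C) :
    (E.withCoin C).weight ψ (k, c) = (((Fintype.card C : ℝ)⁻¹ : ℝ) : ℂ) * E.weight ψ k := by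
  show star ψ ⬝ᵥ (((((Fintype.card C : ℝ)⁻¹ : ℝ) : ℂ) • E.effect k) *ᵥ ψ) = _
  rw [Matrix.smul_mulVec, dotProduct_smul, smul_eq_mul]
  rfl

/-- Real form of `withCoin_weight`. [cite: NielsenChuang2010, §2.2.6 p. 90] -/
theorem withCoin_weight_re (C : Type*) [Fintype C] [Nonempty C] (ψ : X → ℂ) (k : κ) (c : C) :
    ((E.withCoin C).weight ψ (k, c)).re = (Fintype.card C : ℝ)⁻¹ * (E.weight ψ k).re := by
  rw [withCoin_weight, Complex.re_ofReal_mul]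

/-- The weight of outcome `a` of the computational read-out of a statistic `F` is the squared mass of
`F⁻¹(a)`: `⟨ψ|E_a|ψ⟩ = Σ_{w : F w = a} ‖ψ w‖²`. [cite: NielsenChuang2010, §2.2.5 p. 87] -/
theorem readout_weight_re {α : Type*} [Fintype α] [DecidableEq α] (F : X → α) (ψ : X → ℂ) (a : α) :
    ((readout F).weight ψ a).re = ∑ w ∈ Finset.univ.filter (fun w => F w = a), ‖ψ w‖ ^ 2 := by
  unfold weight
  simp only [readout, Matrix.mulVec_diagonal, dotProduct, Pi.star_apply, Complex.star_def]
  rw [Complex.re_sum, Finset.sum_filter]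
  refine Finset.sum_congr rfl fun w _ => ?_
  split_ifs with hw
  · rw [one_mul, Complex.conj_mul', ← Complex.ofReal_pow, Complex.ofReal_re]
  · simp

/-- If `ψ` vanishes on `F⁻¹(a)` the read-out weight of `a` is `0`. [cite: NielsenChuang2010, §2.2.5 p. 87] -/
theorem readout_weight_re_eq_zero {α : Type*} [Fintype α] [DecidableEq α] (F : X → α) {ψ : X → ℂ} {a : α}
    (h : ∀ w, F w = a → ψ w = 0) : ((readout F).weight ψ a).re = 0 := by
  rw [readout_weight_re]
  exact Finset.sum_eq_zero fun w hw => by rw [h w (Finset.mem_filter.1 hw).2, norm_zero, zero_pow two_ne_zero]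

end POVM

/-! ### Counting: pairs of vectors orthogonal on `T`, kernels of linear forms -/

/-- `kerCountT Q T η = #{δ ∈ ℤ_Qⁿ : Σ_{t ∈ T} η_t δ_t = 0}` — the kernel of the linear form `⟨η, ·⟩_T`
(`T = {t₁}`: `kerCount Q (η t₁) · Q^{n−1}`). [folklore] -/
def kerCountT (Q : ℕ) [NeZero Q] {n : ℕ} (T : Finset (Fin n)) (η : Fin n → ZMod Q) : ℕ :=
  (Finset.univ.filter fun δ : Fin n → ZMod Q => ∑ t ∈ T, η t * δ t = 0).card

/-- `pairsCountT Q T = #{(η, δ) ∈ ℤ_Qⁿ × ℤ_Qⁿ : Σ_{t ∈ T} η_t δ_t = 0}` — pairs of vectors ORTHOGONAL ON `T`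
(`T = {t₁}`: `pairsCount Q · Q^{2(n−1)}`; prime `Q`, `#T = r`: `Q^{2n−1} + Q^{2n−r} − Q^{2n−r−1}`). [folklore] -/
def pairsCountT (Q : ℕ) [NeZero Q] {n : ℕ} (T : Finset (Fin n)) : ℕ :=
  (Finset.univ.filter fun p : (Fin n → ZMod Q) × (Fin n → ZMod Q) => ∑ t ∈ T, p.1 t * p.2 t = 0).card

/-- `nonGenericCount Q n T = #{η ∈ ℤ_Qⁿ : no η_t (t ∈ T) is a unit}` (`= (Q − φ(Q))^{#T} · Q^{n − #T}`;
`Q^{n − #T}` for a prime `Q`). [folklore] -/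
def nonGenericCount (Q n : ℕ) [NeZero Q] (T : Finset (Fin n)) : ℕ :=
  (Finset.univ.filter fun η : Fin n → ZMod Q => ∀ t ∈ T, ¬ IsUnit (η t)).card

/-- `pairsCountT Q T = Σ_η kerCountT Q T η`. [folklore] -/
theorem pairsCountT_eq_sum_kerCountT (Q : ℕ) [NeZero Q] {n : ℕ} (T : Finset (Fin n)) :
    pairsCountT Q T = ∑ η : Fin n → ZMod Q, kerCountT Q T η := by
  unfold pairsCountT kerCountT
  rw [Finset.card_filter, Fintype.sum_prod_type]
  refine Finset.sum_congr rfl fun η _ => ?_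
  rw [Finset.card_filter]

/-- `kerCountT Q T η ≤ Qⁿ`. [folklore] -/
theorem kerCountT_le (Q : ℕ) [NeZero Q] {n : ℕ} (T : Finset (Fin n)) (η : Fin n → ZMod Q) :
    kerCountT Q T η ≤ Q ^ n := by
  unfold kerCountT
  refine (Finset.card_filter_le _ _).trans ?_
  rw [Finset.card_univ, Fintype.card_pi, Finset.prod_const, ZMod.card, Finset.card_univ, Fintype.card_fin]

/-- `nonGenericCount Q n T ≤ Qⁿ`. [folklore] -/
theorem nonGenericCount_le (Q n : ℕ) [NeZero Q] (T : Finset (Fin n)) : nonGenericCount Q n T ≤ Q ^ n := by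
  unfold nonGenericCount
  refine (Finset.card_filter_le _ _).trans ?_
  rw [Finset.card_univ, Fintype.card_pi, Finset.prod_const, ZMod.card, Finset.card_univ, Fintype.card_fin]

/-- A coordinate hyperplane of `ℤ_Qⁿ` has `Q^{n−1}` points. [folklore] -/
theorem card_filter_apply_eq_zero (Q : ℕ) [NeZero Q] {n : ℕ} (t₀ : Fin n) :
    (Finset.univ.filter fun β : Fin n → ZMod Q => β t₀ = 0).card = Q ^ (n - 1) := by
  classical
  have h1 := card_mul_sum_apply_coord (R := ℕ) t₀ (fun a : ZMod Q => if a = 0 then 1 else 0)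
  rw [Finset.sum_boole, Finset.sum_boole, ZMod.card] at h1
  have h2 : (Finset.univ.filter fun a : ZMod Q => a = 0).card = 1 := by
    rw [Finset.card_eq_one]
    exact ⟨0, by ext a; simp⟩
  simp only [Nat.cast_id, h2, mul_one] at h1
  have hn : Q ^ n = Q * Q ^ (n - 1) := by
    rw [← pow_succ', Nat.sub_add_cancel (Nat.one_le_of_lt t₀.pos)]
  rw [hn] at h1
  exact Nat.eq_of_mul_eq_mul_left (Nat.pos_of_ne_zero (NeZero.ne Q)) h1

/-- **Kernel of a linear form with a unit coefficient**: if `η_{t₀}` is a unit (`t₀ ∈ T`) then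
`kerCountT Q T η ≤ Q^{n−1}` (`δ_{t₀}` is determined by the other coordinates). [folklore] -/
theorem kerCountT_le_of_isUnit (Q : ℕ) [NeZero Q] {n : ℕ} {T : Finset (Fin n)} {η : Fin n → ZMod Q}
    {t₀ : Fin n} (ht₀ : t₀ ∈ T) (hu : IsUnit (η t₀)) : kerCountT Q T η ≤ Q ^ (n - 1) := by
  classical
  unfold kerCountT
  rw [← card_filter_apply_eq_zero Q t₀]
  refine Finset.card_le_card_of_injOn (fun β => Function.update β t₀ 0) (fun β _ => ?_) ?_
  · exact Finset.mem_coe.2 (Finset.mem_filter.2 ⟨Finset.mem_univ _, Function.update_self _ _ _⟩)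
  · intro β hβ β' hβ' hββ'
    have e := (Finset.mem_filter.1 (Finset.mem_coe.1 hβ)).2
    have e' := (Finset.mem_filter.1 (Finset.mem_coe.1 hβ')).2
    have hoff : ∀ t, t ≠ t₀ → β t = β' t := fun t ht => by
      have := congr_fun hββ' t
      dsimp only at this
      rwa [Function.update_of_ne ht, Function.update_of_ne ht] at this
    have hsum : ∑ t ∈ T, η t * β t = ∑ t ∈ T, η t * β' t := e.trans e'.symm
    have hsplit : ∀ γ : Fin n → ZMod Q,
        ∑ t ∈ T, η t * γ t = η t₀ * γ t₀ + ∑ t ∈ T.erase t₀, η t * γ t := fun γ =>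
      (Finset.add_sum_erase T (fun t => η t * γ t) ht₀).symm
    rw [hsplit β, hsplit β', Finset.sum_congr rfl (fun t ht => by
      rw [hoff t (Finset.ne_of_mem_erase ht)] : ∀ t ∈ T.erase t₀, η t * β t = η t * β' t),
      add_left_inj] at hsum
    have ht₀eq : β t₀ = β' t₀ := hu.mul_left_cancel hsum
    funext t
    by_cases ht : t = t₀
    · rw [ht]; exact ht₀eq
    · exact hoff t ht

/-- **Counting bound**: `Q · pairsCountT Q T ≤ Qⁿ · (Qⁿ + (Q − 1) · nonGenericCount Q n T)` — kernels
have `≤ Q^{n−1}` points for the `Qⁿ − nonGenericCount` slope vectors with a unit on `T`, `≤ Qⁿ` otherwise.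
[folklore] -/
theorem mul_pairsCountT_le (Q : ℕ) [NeZero Q] {n : ℕ} (T : Finset (Fin n)) :
    Q * pairsCountT Q T ≤ Q ^ n * (Q ^ n + (Q - 1) * nonGenericCount Q n T) := by
  classical
  rw [pairsCountT_eq_sum_kerCountT, Finset.mul_sum]
  have hpt : ∀ η : Fin n → ZMod Q,
      Q * kerCountT Q T η ≤ if (∀ t ∈ T, ¬ IsUnit (η t)) then Q ^ (n + 1) else Q ^ n := by
    intro η
    split_ifs with hη
    · rw [pow_succ']
      exact Nat.mul_le_mul_left _ (kerCountT_le Q T η)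
    · push Not at hη
      obtain ⟨t₀, ht₀, hu⟩ := hη
      calc Q * kerCountT Q T η ≤ Q * Q ^ (n - 1) := Nat.mul_le_mul_left _ (kerCountT_le_of_isUnit Q ht₀ hu)
        _ = Q ^ n := by rw [← pow_succ', Nat.sub_add_cancel (Nat.one_le_of_lt t₀.pos)]
  refine (Finset.sum_le_sum fun η _ => hpt η).trans (le_of_eq ?_)
  rw [Finset.sum_ite, Finset.sum_const, Finset.sum_const, smul_eq_mul, smul_eq_mul]
  have hc := Finset.card_filter_add_card_filter_not (s := (Finset.univ : Finset (Fin n → ZMod Q)))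
    (fun η : Fin n → ZMod Q => ∀ t ∈ T, ¬ IsUnit (η t))
  rw [Finset.card_univ, Fintype.card_pi, Finset.prod_const, ZMod.card, Finset.card_univ, Fintype.card_fin]
    at hc
  have hNG : (Finset.univ.filter fun η : Fin n → ZMod Q => ∀ t ∈ T, ¬ IsUnit (η t)).card
      = nonGenericCount Q n T := rfl
  rw [hNG] at hc ⊢
  set A := nonGenericCount Q n T
  set B := (Finset.univ.filter fun η : Fin n → ZMod Q => ¬ ∀ t ∈ T, ¬ IsUnit (η t)).card
  have hQ1 : 1 ≤ Q := Nat.pos_of_ne_zero (NeZero.ne Q)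
  zify [hQ1] at hc ⊢
  have hB : (B : ℤ) = (Q : ℤ) ^ n - A := by linarith
  rw [hB, pow_succ]
  ring

/-- Real form: `pairsCountT Q T / Q^{2n} ≤ 1/Q + (1 − 1/Q) · nonGenericCount/Qⁿ`. [folklore] -/
theorem pairsCountT_div_le (Q : ℕ) [NeZero Q] {n : ℕ} (T : Finset (Fin n)) :
    (pairsCountT Q T : ℝ) / (Q : ℝ) ^ (2 * n)
      ≤ 1 / (Q : ℝ) + (1 - 1 / (Q : ℝ)) * ((nonGenericCount Q n T : ℝ) / (Q : ℝ) ^ n) := by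
  have hQ : (0 : ℝ) < Q := by exact_mod_cast Nat.pos_of_ne_zero (NeZero.ne Q)
  have hQ1 : 1 ≤ Q := Nat.pos_of_ne_zero (NeZero.ne Q)
  have h := mul_pairsCountT_le Q T
  have h' : ((Q : ℝ)) * (pairsCountT Q T : ℝ) ≤ (Q : ℝ) ^ n * ((Q : ℝ) ^ n + ((Q : ℝ) - 1) * nonGenericCount Q n T) := by
    have := (Nat.cast_le (α := ℝ)).2 h
    push_cast [Nat.cast_sub hQ1] at this
    exact this
  rw [div_le_iff₀ (by positivity)]
  have hQn : (0 : ℝ) < (Q : ℝ) ^ n := by positivity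
  calc (pairsCountT Q T : ℝ) = (Q : ℝ)⁻¹ * ((Q : ℝ) * pairsCountT Q T) := by
        rw [← mul_assoc, inv_mul_cancel₀ hQ.ne', one_mul]
    _ ≤ (Q : ℝ)⁻¹ * ((Q : ℝ) ^ n * ((Q : ℝ) ^ n + ((Q : ℝ) - 1) * nonGenericCount Q n T)) :=
        mul_le_mul_of_nonneg_left h' (inv_nonneg.2 hQ.le)
    _ = _ := by
        field_simp
        ring

/-- `#{a ∈ ℤ_Q : a not a unit} = Q − φ(Q)`. [folklore] -/
theorem card_filter_not_isUnit (Q : ℕ) [NeZero Q] :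
    (Finset.univ.filter fun a : ZMod Q => ¬ IsUnit a).card = Q - Q.totient := by
  have h1 : (Finset.univ.filter fun a : ZMod Q => IsUnit a).card = Q.totient := by
    rw [← ZMod.card_units_eq_totient Q, ← Finset.card_univ,
      ← Finset.card_image_of_injective Finset.univ Units.val_injective]
    congr 1
    ext a
    simp only [Finset.mem_filter, Finset.mem_univ, true_and, Finset.mem_image]
    exact ⟨fun ⟨u, hu⟩ => ⟨u, hu⟩, fun ⟨u, hu⟩ => ⟨u, hu⟩⟩
  have h2 := Finset.card_filter_add_card_filter_not (s := (Finset.univ : Finset (ZMod Q)))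
    (fun a : ZMod Q => IsUnit a)
  rw [Finset.card_univ, ZMod.card, h1] at h2
  omega

/-- `nonGenericCount Q n T = (Q − φ(Q))^{#T} · Q^{n − #T}`. [folklore] -/
theorem nonGenericCount_eq (Q n : ℕ) [NeZero Q] (T : Finset (Fin n)) :
    nonGenericCount Q n T = (Q - Q.totient) ^ T.card * Q ^ (n - T.card) := by
  classical
  unfold nonGenericCount
  have hset : (Finset.univ.filter fun η : Fin n → ZMod Q => ∀ t ∈ T, ¬ IsUnit (η t))
      = Fintype.piFinset fun t : Fin n =>
          if t ∈ T then Finset.univ.filter (fun a : ZMod Q => ¬ IsUnit a) else Finset.univ := by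
    ext η
    simp only [Finset.mem_filter, Finset.mem_univ, true_and, Fintype.mem_piFinset]
    constructor
    · intro h t
      split_ifs with ht
      · exact Finset.mem_filter.2 ⟨Finset.mem_univ _, h t ht⟩
      · exact Finset.mem_univ _
    · intro h t ht
      have := h t
      rw [if_pos ht] at this
      exact (Finset.mem_filter.1 this).2
  rw [hset, Fintype.card_piFinset]
  rw [Finset.prod_congr rfl fun t _ => apply_ite Finset.card (t ∈ T)
    (Finset.univ.filter (fun a : ZMod Q => ¬ IsUnit a)) Finset.univ]
  rw [Finset.prod_ite, Finset.prod_const, Finset.prod_const, card_filter_not_isUnit, Finset.card_univ,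
    ZMod.card]
  congr 2
  · rw [Finset.filter_mem_eq_inter, Finset.univ_inter]
  · have : (Finset.univ.filter fun t : Fin n => ¬ t ∈ T) = Tᶜ := by
      ext t; simp
    rw [this, Finset.card_compl, Fintype.card_fin]

/-- For a prime `Q`: `nonGenericCount Q n T = Q^{n − #T}`. [folklore] -/
theorem nonGenericCount_prime {Q : ℕ} [Fact Q.Prime] {n : ℕ} (T : Finset (Fin n)) :
    nonGenericCount Q n T = Q ^ (n - T.card) := by
  rw [nonGenericCount_eq, Nat.totient_prime (Fact.out), Nat.sub_sub_self (Fact.out : Q.Prime).one_le,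
    one_pow, one_mul]

/-- `nonGenericCount/Qⁿ = ((Q − φ(Q))/Q)^{#T}` (`#T ≤ n`). [folklore] -/
theorem nonGenericCount_div_eq (Q n : ℕ) [NeZero Q] (T : Finset (Fin n)) :
    (nonGenericCount Q n T : ℝ) / (Q : ℝ) ^ n = (((Q - Q.totient : ℕ) : ℝ) / Q) ^ T.card := by
  have hQ : (Q : ℝ) ≠ 0 := by exact_mod_cast NeZero.ne Q
  have hT : T.card ≤ n := by simpa using Finset.card_le_univ T
  rw [nonGenericCount_eq, div_pow, div_eq_div_iff (pow_ne_zero _ hQ) (pow_ne_zero _ hQ)]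
  push_cast
  rw [mul_assoc, ← pow_add, Nat.sub_add_cancel hT]

/-- For a prime `Q`: `nonGenericCount/Qⁿ = 1/Q^{#T}`. [folklore] -/
theorem nonGenericCount_div_eq_prime {Q : ℕ} [Fact Q.Prime] {n : ℕ} (T : Finset (Fin n)) :
    (nonGenericCount Q n T : ℝ) / (Q : ℝ) ^ n = 1 / (Q : ℝ) ^ T.card := by
  haveI : NeZero Q := ⟨(Fact.out : Q.Prime).ne_zero⟩
  rw [nonGenericCount_div_eq, Nat.totient_prime (Fact.out), Nat.sub_sub_self (Fact.out : Q.Prime).one_le,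
    Nat.cast_one, div_pow, one_pow]

/-- **Consistency with one dummy**: `Q² · pairsCountT Q {t₁} = Q^{2n} · pairsCount Q`, so the bound of
this file with `T = {t₁}` is exactly `pairsCount(Q)/Q²` of `Shape.step9Needs_readout_le`. [folklore] -/
theorem sq_mul_pairsCountT_singleton (Q : ℕ) [NeZero Q] {n : ℕ} (t₁ : Fin n) :
    Q ^ 2 * pairsCountT Q ({t₁} : Finset (Fin n)) = Q ^ (2 * n) * pairsCount Q := by
  classical
  have hker : ∀ η : Fin n → ZMod Q, Q * kerCountT Q ({t₁} : Finset (Fin n)) η = Q ^ n * kerCount Q (η t₁) := by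
    intro η
    unfold kerCountT kerCount
    have h1 := card_mul_sum_apply_coord (R := ℕ) t₁ (fun a : ZMod Q => if η t₁ * a = 0 then 1 else 0)
    rw [Finset.sum_boole, Finset.sum_boole, ZMod.card] at h1
    simpa only [Nat.cast_id, Finset.sum_singleton] using h1
  have h2 := card_mul_sum_apply_coord (R := ℕ) t₁ (fun a : ZMod Q => kerCount Q a)
  rw [ZMod.card] at h2
  simp only [Nat.cast_id] at h2
  rw [pairsCountT_eq_sum_kerCountT, pairsCount_eq_sum_kerCount, pow_two, mul_assoc, Finset.mul_sum]
  simp_rw [hker]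
  rw [← Finset.mul_sum, mul_left_comm, h2, ← mul_assoc, ← pow_add, two_mul]

/-- Fibres of `β ↦ −2(x + (σ₀ + Σ_{t∈T} η_t β_t))` on `ℤ_Qⁿ` are translates of the kernel: at most
`kerCountT Q T η` points each (`Q` odd). [folklore] -/
theorem card_fibre_le_kerCountT {Q : ℕ} [NeZero Q] (hQ : Odd Q) {n : ℕ} (T : Finset (Fin n))
    (x σ₀ : ZMod Q) (η : Fin n → ZMod Q) (m : ZMod Q) :
    (Finset.univ.filter fun β : Fin n → ZMod Q => -2 * (x + (σ₀ + ∑ t ∈ T, η t * β t)) = m).card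
      ≤ kerCountT Q T η := by
  classical
  by_cases hne : (Finset.univ.filter fun β : Fin n → ZMod Q => -2 * (x + (σ₀ + ∑ t ∈ T, η t * β t)) = m).Nonempty
  · obtain ⟨β₀, hβ₀⟩ := hne
    have h₀ := (Finset.mem_filter.1 hβ₀).2
    unfold kerCountT
    refine Finset.card_le_card_of_injOn (fun β => β - β₀) (fun β hβ => ?_) ?_
    · have hβ' := (Finset.mem_filter.1 (Finset.mem_coe.1 hβ)).2
      refine Finset.mem_coe.2 (Finset.mem_filter.2 ⟨Finset.mem_univ _, ?_⟩)
      have hsub : ∑ t ∈ T, η t * (β - β₀) t = ∑ t ∈ T, η t * β t - ∑ t ∈ T, η t * β₀ t := by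
        simp only [Pi.sub_apply, mul_sub, Finset.sum_sub_distrib]
      rw [hsub]
      apply eq_zero_of_two_mul_eq_zero hQ
      linear_combination h₀ - hβ'
    · intro β _ β' _ hββ'
      simpa using hββ'
  · rw [Finset.not_nonempty_iff_eq_empty.1 hne, Finset.card_empty]
    exact Nat.zero_le _

/-- Real form of `sq_mul_pairsCountT_singleton`: `pairsCountT(Q,{t₁})/Q^{2n} = pairsCount(Q)/Q²`. [folklore] -/
theorem pairsCountT_singleton_div (Q : ℕ) [NeZero Q] {n : ℕ} (t₁ : Fin n) :
    (pairsCountT Q ({t₁} : Finset (Fin n)) : ℝ) / (Q : ℝ) ^ (2 * n) = (pairsCount Q : ℝ) / (Q : ℝ) ^ 2 := by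
  have hQ : (Q : ℝ) ≠ 0 := by exact_mod_cast NeZero.ne Q
  have h := sq_mul_pairsCountT_singleton Q t₁
  have h' : ((Q : ℝ)) ^ 2 * (pairsCountT Q ({t₁} : Finset (Fin n)) : ℝ) = (Q : ℝ) ^ (2 * n) * pairsCount Q := by
    exact_mod_cast h
  rw [div_eq_div_iff (pow_ne_zero _ hQ) (pow_ne_zero _ hQ)]
  linear_combination h'

/-! ### The lower side: blind guessing scores exactly `1/Q` -/

namespace Shape

variable (S : Shape)

/-- **The blind-guess decoder.** From the head coordinate `a = w₀` of the Step-8 outcome (which determines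
`v′₀ mod D²p₁`, Claim 3.14) and an independent uniform coin `c ∈ ℤ_Q` output `D·a + D²p₁·c (mod D²P)`:
i.e. GUESS the missing residue `v′₀ mod Q` (given `v′₀ mod D²p₁`) uniformly at random.
[cite: ChenQuantumLattice2024, Claim 3.14 p. 33, §3.5.9 p. 37] -/
def blindDec (k : ZMod S.M × ZMod S.Q) : ZMod S.N :=
  ((((S.D : ℕ) : ℤ) * (k.1.val : ℤ) + ((S.D : ℕ) : ℤ) * (S.D : ℕ) * (S.p₁ : ℕ) * (k.2.val : ℤ) : ℤ) : ZMod S.N)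

/-- On the support of `|φ7.d⟩` exactly ONE coin value makes the blind guess correct (`w₀` fixes
`v′₀ mod D²p₁` by Claim 3.14; the `Q` coin values enumerate the `Q` lifts to `ℤ_{D²P}`).
[cite: ChenQuantumLattice2024, Claim 3.14 p. 33] -/
theorem blindDec_correct_iff (h : S.Admissible) {w : Fin (S.n + 1) → ZMod S.M} (hw : S.pred8 w) :
    ∃ c₀ : ZMod S.Q, ∀ c : ZMod S.Q, S.blindDec (w 0, c) = S.step9Needs ↔ c = c₀ := by
  have hP : (S.p₁ : ℕ) ∣ (S.P : ℕ) := ⟨S.Q, by rw [P, PNat.mul_coe]⟩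
  have hres := S.head_residue_of_pred8 h hP
    (fun i hi => (dvd_mul_left (S.p₁ : ℤ) 2).trans (h.b_tail i hi)) hw
  rw [ZMod.intCast_eq_intCast_iff_dvd_sub] at hres
  obtain ⟨j, hj⟩ := hres
  obtain ⟨u, hu⟩ := h.v'_in_DZ 0
  have hD0 : (S.D : ℤ) ≠ 0 := by exact_mod_cast S.D.ne_zero
  have hp0 : (S.p₁ : ℤ) ≠ 0 := by exact_mod_cast S.p₁.ne_zero
  have hDDp : (S.D : ℤ) * S.D * S.p₁ ≠ 0 := mul_ne_zero (mul_ne_zero hD0 hD0) hp0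
  have hu' : S.v' 0 / S.D = u := by rw [hu, Int.mul_ediv_cancel_left _ hD0]
  rw [hu'] at hj
  push_cast at hj
  refine ⟨(j : ZMod S.Q), fun c => ?_⟩
  unfold blindDec step9Needs
  rw [ZMod.intCast_eq_intCast_iff_dvd_sub, N_eq_DDpQ]
  have key : S.v' 0 - (((S.D : ℕ) : ℤ) * ((w 0).val : ℤ)
        + ((S.D : ℕ) : ℤ) * (S.D : ℕ) * (S.p₁ : ℕ) * (c.val : ℤ))
      = ((S.D : ℤ) * S.D * S.p₁) * (j - (c.val : ℤ)) := by
    rw [hu]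
    linear_combination ((S.D : ℤ)) * hj
  rw [key, mul_dvd_mul_iff_left hDDp]
  constructor
  · intro hd
    have := (ZMod.intCast_eq_intCast_iff_dvd_sub (c.val : ℤ) j S.Q).2 hd
    rwa [Int.cast_natCast, ZMod.natCast_zmod_val] at this
  · rintro rfl
    refine (ZMod.intCast_eq_intCast_iff_dvd_sub _ _ _).1 ?_
    rw [Int.cast_natCast, ZMod.natCast_zmod_val]

/-- **ACHIEVABILITY: blind guessing scores exactly `1/Q` on every admissible instance.** Read the head
coordinate `w₀` of the Step-8 register, toss a uniform `Q`-sided coin, output `blindDec`: the success weight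
for the Step-9 datum `v′₀ mod D²P` is EXACTLY `⟨φ7.d|φ7.d⟩/Q`, whatever the admissible shape.
[cite: ChenQuantumLattice2024, Claim 3.14 p. 33, §3.5.9 p. 37; NielsenChuang2010, §2.2.5 p. 87] -/
theorem blindGuess_weight_eq (h : S.Admissible) :
    ∑ k ∈ Finset.univ.filter (fun k => S.blindDec k = S.step9Needs),
        (((POVM.readout fun w : Fin (S.n + 1) → ZMod S.M => w 0).withCoin (ZMod S.Q)).weight S.phi7d k).re
      = (1 / ((S.Q : ℕ) : ℝ)) * (star S.phi7d ⬝ᵥ S.phi7d).re := by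
  classical
  set E := POVM.readout fun w : Fin (S.n + 1) → ZMod S.M => w 0 with hE
  rw [Finset.sum_filter, Fintype.sum_prod_type]
  have hcard : (Fintype.card (ZMod S.Q) : ℝ)⁻¹ = 1 / ((S.Q : ℕ) : ℝ) := by
    rw [ZMod.card, one_div]
  -- per head value `a`: exactly one coin value scores, unless the weight of `a` vanishes
  have ha : ∀ a : ZMod S.M,
      (∑ c : ZMod S.Q, if S.blindDec (a, c) = S.step9Needs
          then ((E.withCoin (ZMod S.Q)).weight S.phi7d (a, c)).re else 0)
        = (1 / ((S.Q : ℕ) : ℝ)) * (E.weight S.phi7d a).re := by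
    intro a
    simp_rw [POVM.withCoin_weight_re, hcard]
    rw [← Finset.sum_filter, Finset.sum_const, nsmul_eq_mul]
    by_cases h0 : ∀ w : Fin (S.n + 1) → ZMod S.M, w 0 = a → S.phi7d w = 0
    · rw [hE, POVM.readout_weight_re_eq_zero _ h0, mul_zero, mul_zero]
    · push Not at h0
      obtain ⟨w, rfl, hw⟩ := h0
      obtain ⟨c₀, hc₀⟩ := S.blindDec_correct_iff h ((S.phi7d_ne_zero_iff h w).1 hw)
      have h1 : (Finset.univ.filter fun c : ZMod S.Q => S.blindDec (w 0, c) = S.step9Needs) = {c₀} := by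
        ext c
        simp [hc₀ c]
      rw [h1, Finset.card_singleton, Nat.cast_one, one_mul]
  simp_rw [ha]
  rw [← Finset.mul_sum, hE, E.sum_weight_re]

/-- The same on every admissible INSTANCE of the shape (same public `n, D, p₁, Q`, same measurement and
decoder): blind guessing scores exactly `⟨φ7.d|φ7.d⟩/Q` whatever `b` (the LWE secret and error) and `v′`.
[cite: ChenQuantumLattice2024, Claim 3.14 p. 33, §3.5.9 p. 37] -/
theorem blindGuess_weight_eq_inst {b₂ v₂ : Fin (S.n + 1) → ℤ} (hI : (S.inst b₂ v₂).Admissible) :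
    ∑ k ∈ Finset.univ.filter (fun k => S.blindDec k = (S.inst b₂ v₂).step9Needs),
        (((POVM.readout fun w : Fin (S.n + 1) → ZMod S.M => w 0).withCoin (ZMod S.Q)).weight
          (S.inst b₂ v₂).phi7d k).re
      = (1 / ((S.Q : ℕ) : ℝ)) * (star (S.inst b₂ v₂).phi7d ⬝ᵥ (S.inst b₂ v₂).phi7d).re :=
  (S.inst b₂ v₂).blindGuess_weight_eq hI

/-! ### The dummy family on `T` and the upper side -/


/-- Tail slope data of the dummy family on `T`: the true `b_{t+1}/(2p₁)` off `T`, shifted by a dummy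
`β_t` at each unknown coordinate `t+1`, `t ∈ T`. [cite: ChenQuantumLattice2024, §3.1 p. 22] -/
def BfamT (T : Finset (Fin S.n)) (β : Fin S.n → ZMod S.Q) (t : Fin S.n) : ℤ :=
  S.b t.succ / (2 * (S.p₁ : ℤ)) + if t ∈ T then ((β t).val : ℤ) else 0

/-- The slope vector of the family: `(−1, 2p₁·BfamT)`. [cite: ChenQuantumLattice2024, §3.1 p. 22] -/
def famBT (T : Finset (Fin S.n)) (β : Fin S.n → ZMod S.Q) : Fin (S.n + 1) → ℤ :=
  Fin.cons (-1) fun t => 2 * (S.p₁ : ℤ) * S.BfamT T β t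

/-- `famBT β 0 = −1`. [cite: ChenQuantumLattice2024, Cond. C.3 p. 18] -/
@[simp] theorem famBT_zero (T : Finset (Fin S.n)) (β : Fin S.n → ZMod S.Q) : S.famBT T β 0 = -1 := by
  simp [famBT]
/-- `famBT β (t+1) = 2p₁·BfamT β t`. [cite: ChenQuantumLattice2024, Cond. C.3 p. 18] -/
@[simp] theorem famBT_succ (T : Finset (Fin S.n)) (β : Fin S.n → ZMod S.Q) (t : Fin S.n) :
    S.famBT T β t.succ = 2 * (S.p₁ : ℤ) * S.BfamT T β t := by
  simp [famBT]

/-- Every member of the family lies in the class of any `U ⊇ T+1`. [cite: ChenQuantumLattice2024, Cond. C.3 p. 18, §3.1 p. 22] -/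
theorem inClass_famT (h : S.Admissible) (T : Finset (Fin S.n)) {U : Finset (Fin (S.n + 1))}
    (hU : ∀ t ∈ T, t.succ ∈ U) (β : Fin S.n → ZMod S.Q) (c : Fin (S.n + 1) → ℤ) :
    S.InClass U (S.famBT T β) (S.vOf c) := by
  refine ⟨fun i hi => ?_, S.inst_vOf_admissible h (S.famBT_zero T β) (fun i hi0 => ?_) c⟩
  · revert hi
    refine Fin.cases ?_ (fun t => ?_) i
    · intro _
      rw [famBT_zero, h.b_head]
    · intro ht
      have hne : t ∉ T := fun htT => ht (hU t htT)
      rw [famBT_succ, BfamT, if_neg hne, add_zero]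
      exact Int.mul_ediv_cancel' (h.b_tail t.succ (Fin.succ_ne_zero t))
  · obtain ⟨t, rfl⟩ := Fin.exists_succ_eq.2 hi0
    rw [famBT_succ]
    exact dvd_mul_right _ _

/-- `σ_{BfamT β}(η) = σ₀(η) + Σ_{t ∈ T} η_t β_t`. [folklore] -/
theorem sig_BfamT (T : Finset (Fin S.n)) (β η : Fin S.n → ZMod S.Q) :
    S.sig (S.BfamT T β) η = S.sig (fun t => S.b t.succ / (2 * (S.p₁ : ℤ))) η + ∑ t ∈ T, η t * β t := by
  unfold sig BfamT
  simp only [Int.cast_add, Int.cast_ite, Int.cast_natCast, ZMod.natCast_zmod_val, Int.cast_zero, mul_add,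
    Finset.sum_add_distrib, mul_ite, mul_zero]
  rw [Finset.sum_ite_mem, Finset.univ_inter]

/-- **READ-OUT BOUND WITH `#T` DUMMIES (upper side of the order).** Let the Step-8 register hold `|φ7.d⟩`
of an admissible instance of the class "slopes unknown at the coordinates `T+1`" and let ANY general
measurement (POVM `E`, any outcome type) followed by ANY classical decoder try to output the Step-9 datum
`v′₀ mod D²P`. Then on some instance of the class the success weight is at most
`pairsCountT(Q,T)/Q^{2n} · ⟨φ7.d|φ7.d⟩` — the probability that two uniform vectors of `ℤ_Qⁿ` are orthogonal on
`T` — which is `≤ 1/Q + (1 − 1/Q)·((Q − φ(Q))/Q)^{#T}` (`= 1/Q + (1 − 1/Q)/Q^{#T}` for prime `Q`,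
`pairsCount(Q)/Q²` for `#T = 1`): averaging over the `Q^{2n+1}` instances `(β, x, ȳ)`, the partial Fourier
transform in `ȳ` block-diagonalises into the frames `w_{η,·}`; in block `η` the `Q` head offsets with the
same `m = −2(x + σ₀(η) + Σ_{t∈T} η_t β_t)` present the SAME state but need DIFFERENT answers, and `β ↦ m`
is `kerCountT(η)`-to-one. [cite: ChenQuantumLattice2024, §3.5.8 pp. 33–34, §3.5.9 p. 37; NielsenChuang2010, §2.2.6 p. 90] -/
theorem step9Needs_readout_le_dummies (h : S.Admissible) (T : Finset (Fin S.n))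
    {U : Finset (Fin (S.n + 1))} (hU : ∀ t ∈ T, t.succ ∈ U) {κ : Type*} [Fintype κ] [DecidableEq κ]
    (E : POVM (Fin (S.n + 1) → ZMod S.M) κ) (dec : κ → ZMod S.N) :
    ∃ b₂ v₂ : Fin (S.n + 1) → ℤ, S.InClass U b₂ v₂ ∧
      (∑ k ∈ Finset.univ.filter (fun k => dec k = (S.inst b₂ v₂).step9Needs),
          (E.weight (S.inst b₂ v₂).phi7d k).re)
        ≤ (pairsCountT (S.Q : ℕ) T : ℝ) / ((S.Q : ℕ) : ℝ) ^ (2 * S.n)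
            * (star (S.inst b₂ v₂).phi7d ⬝ᵥ (S.inst b₂ v₂).phi7d).re := by
  -- opaque abbreviations: labels `ℓ`, frame read-out weights `g`, the known part `σ₀` of `σ`
  obtain ⟨ℓ, hℓ⟩ : ∃ ℓ : ZMod S.Q → ZMod S.N, ∀ x, ℓ x = (((S.v' 0 + S.L * x.val : ℤ)) : ZMod S.N) :=
    ⟨_, fun _ => rfl⟩
  obtain ⟨g, hg⟩ : ∃ g : (Fin S.n → ZMod S.Q) → ZMod S.Q → ZMod S.Q → ℝ, ∀ η m x, g η m x
      = ∑ k ∈ Finset.univ.filter (fun k => dec k = ℓ x), (E.weight (S.step8Map (S.wv η m)) k).re :=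
    ⟨_, fun _ _ _ => rfl⟩
  obtain ⟨σ₀, hσ₀⟩ : ∃ σ₀ : (Fin S.n → ZMod S.Q) → ZMod S.Q,
      ∀ η, σ₀ η = S.sig (fun t => S.b t.succ / (2 * (S.p₁ : ℤ))) η := ⟨_, fun _ => rfl⟩
  set n₀ : ℝ := (((S.M : ℕ) : ℝ) * (S.D : ℕ)) ^ (S.n + 1) * (((S.P : ℕ) : ℝ) * 2 ^ S.n) with hn₀
  have hQpos : (0 : ℝ) < ((S.Q : ℕ) : ℝ) := by exact_mod_cast S.Q.pos
  have hg0 : ∀ η m x, 0 ≤ g η m x := fun η m x => by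
    rw [hg]; exact Finset.sum_nonneg fun k _ => E.weight_re_nonneg _ k
  -- (K0) labels and norms of the family
  have hlabel : ∀ (β : Fin S.n → ZMod S.Q) (x : ZMod S.Q) (yb : Fin S.n → ZMod S.Q),
      (S.inst (S.famBT T β) (S.vOf (S.xyv x yb))).step9Needs = ℓ x := fun β x yb => by
    rw [hℓ, step9Needs_fam]
  have hnorm : ∀ (β : Fin S.n → ZMod S.Q) (x : ZMod S.Q) (yb : Fin S.n → ZMod S.Q),
      (star (S.inst (S.famBT T β) (S.vOf (S.xyv x yb))).phi7d
        ⬝ᵥ (S.inst (S.famBT T β) (S.vOf (S.xyv x yb))).phi7d).re = n₀ := by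
    intro β x yb
    rw [S.star_phi7d_dotProduct_phi7d_inst (S.inClass_famT h T hU β _).2]
    have hc : (((S.M : ℕ) : ℂ) * (S.D : ℕ)) ^ (S.n + 1) * (((S.P : ℕ) : ℂ) * 2 ^ S.n) = ((n₀ : ℝ) : ℂ) := by
      rw [hn₀]; push_cast; ring
    rw [hc, Complex.ofReal_re]
  -- (K1) sandwich over the tail offsets, real form
  have hK1 : ∀ (β : Fin S.n → ZMod S.Q) (x : ZMod S.Q), ∑ yb : Fin S.n → ZMod S.Q,
      ∑ k ∈ Finset.univ.filter (fun k => dec k = ℓ x),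
        (E.weight (S.inst (S.famBT T β) (S.vOf (S.xyv x yb))).phi7d k).re
      = (1 / ((S.Q : ℕ) : ℝ) ^ S.n) * ∑ η, g η (-2 * (x + (σ₀ η + ∑ t ∈ T, η t * β t))) x := by
    intro β x
    have hc := S.sum_weight_fam_eq E (Finset.univ.filter (fun k => dec k = ℓ x)) (S.BfamT T β)
      (S.famBT_zero T β) (S.famBT_succ T β) x
    simp_rw [S.sig_BfamT, ← hσ₀] at hc
    have hre := congrArg Complex.re hc
    simp_rw [Complex.re_sum] at hre
    rw [hre]
    have hcast : (1 / ((S.Q : ℕ) : ℂ) ^ S.n) = (((1 / ((S.Q : ℕ) : ℝ) ^ S.n : ℝ)) : ℂ) := by push_cast; ring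
    rw [hcast, Complex.re_ofReal_mul, Complex.re_sum]
    congr 1
    refine Finset.sum_congr rfl fun η _ => ?_
    rw [hg, Complex.re_sum]
  -- (K2) the dummy slopes: `β ↦ m` is `kerCountT(η)`-to-one
  have hK2 : ∀ (η : Fin S.n → ZMod S.Q) (x : ZMod S.Q),
      ∑ β : Fin S.n → ZMod S.Q, g η (-2 * (x + (σ₀ η + ∑ t ∈ T, η t * β t))) x
        ≤ (kerCountT (S.Q : ℕ) T η : ℝ) * ∑ m, g η m x := fun η x =>
    sum_comp_le_of_card_fibre_le (fun β : Fin S.n → ZMod S.Q => -2 * (x + (σ₀ η + ∑ t ∈ T, η t * β t)))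
      (fun m => g η m x) (fun m => hg0 η m x) _ (fun m => card_fibre_le_kerCountT h.odd_Q T x (σ₀ η) η m)
  -- (K3) the head offset: `Q` distinct answers from one frame state
  have hK3 : ∀ (η : Fin S.n → ZMod S.Q) (m : ZMod S.Q),
      ∑ x : ZMod S.Q, g η m x ≤ ((S.Q : ℕ) : ℝ) ^ S.n * n₀ := by
    intro η m
    simp_rw [hg]
    have h1 := E.sum_sum_filter_weight_re_le dec Finset.univ ℓ
      (fun x _ x' _ hxx => S.label_inj h (by rw [← hℓ, ← hℓ]; exact hxx)) (S.step8Map (S.wv η m))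
    refine h1.trans (le_of_eq ?_)
    rw [S.dotProduct_step8Map _ _ (fun z hz => S.wv_support_D h hz), S.star_wv_dotProduct_wv h]
    have hc : (((S.M : ℕ) : ℂ) * (S.D : ℕ)) ^ (S.n + 1) * (((S.P : ℕ) : ℂ) * 2 ^ S.n * ((S.Q : ℕ) : ℂ) ^ S.n)
        = (((((S.Q : ℕ) : ℝ) ^ S.n * n₀ : ℝ)) : ℂ) := by
      rw [hn₀]; push_cast; ring
    rw [hc, Complex.ofReal_re]
  -- (K4) counting: `Σ_η kerCountT(η) = pairsCountT`
  have hK4 : ∑ η : Fin S.n → ZMod S.Q, (kerCountT (S.Q : ℕ) T η : ℝ) = (pairsCountT (S.Q : ℕ) T : ℝ) := by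
    rw [pairsCountT_eq_sum_kerCountT]; push_cast; rfl
  -- total over the family
  have htot : ∑ p : (Fin S.n → ZMod S.Q) × ZMod S.Q × (Fin S.n → ZMod S.Q),
      ∑ k ∈ Finset.univ.filter (fun k => dec k = ℓ p.2.1),
        (E.weight (S.inst (S.famBT T p.1) (S.vOf (S.xyv p.2.1 p.2.2))).phi7d k).re
      ≤ ((S.Q : ℕ) : ℝ) * (pairsCountT (S.Q : ℕ) T : ℝ) * n₀ := by
    rw [Fintype.sum_prod_type]
    simp_rw [Fintype.sum_prod_type]
    simp_rw [hK1]
    simp_rw [← Finset.mul_sum]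
    rw [sum_sum_sum_comm₃]
    have hstep : ∑ η : Fin S.n → ZMod S.Q, ∑ x : ZMod S.Q,
        ∑ β : Fin S.n → ZMod S.Q, g η (-2 * (x + (σ₀ η + ∑ t ∈ T, η t * β t))) x
        ≤ ∑ η : Fin S.n → ZMod S.Q, ∑ x : ZMod S.Q, (kerCountT (S.Q : ℕ) T η : ℝ) * ∑ m, g η m x :=
      Finset.sum_le_sum fun η _ => Finset.sum_le_sum fun x _ => hK2 η x
    calc (1 / ((S.Q : ℕ) : ℝ) ^ S.n) * ∑ η : Fin S.n → ZMod S.Q, ∑ x : ZMod S.Q,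
          ∑ β : Fin S.n → ZMod S.Q, g η (-2 * (x + (σ₀ η + ∑ t ∈ T, η t * β t))) x
        ≤ (1 / ((S.Q : ℕ) : ℝ) ^ S.n)
            * ∑ η : Fin S.n → ZMod S.Q, ∑ x : ZMod S.Q, (kerCountT (S.Q : ℕ) T η : ℝ) * ∑ m, g η m x :=
          mul_le_mul_of_nonneg_left hstep (by positivity)
      _ = (1 / ((S.Q : ℕ) : ℝ) ^ S.n)
            * ∑ η, (kerCountT (S.Q : ℕ) T η : ℝ) * ∑ m, ∑ x : ZMod S.Q, g η m x := by
          congr 1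
          refine Finset.sum_congr rfl fun η _ => ?_
          rw [← Finset.mul_sum, Finset.sum_comm]
      _ ≤ (1 / ((S.Q : ℕ) : ℝ) ^ S.n) * ∑ η : Fin S.n → ZMod S.Q,
            (kerCountT (S.Q : ℕ) T η : ℝ) * ∑ m : ZMod S.Q, ((S.Q : ℕ) : ℝ) ^ S.n * n₀ :=
          mul_le_mul_of_nonneg_left (Finset.sum_le_sum fun η _ =>
            mul_le_mul_of_nonneg_left (Finset.sum_le_sum fun m _ => hK3 η m) (Nat.cast_nonneg _))
            (by positivity)
      _ = ((S.Q : ℕ) : ℝ) * (pairsCountT (S.Q : ℕ) T : ℝ) * n₀ := by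
          rw [Finset.sum_const, Finset.card_univ, ZMod.card, nsmul_eq_mul, ← Finset.sum_mul, hK4]
          have hQn : ((S.Q : ℕ) : ℝ) ^ S.n ≠ 0 := by positivity
          field_simp
  -- the same total, as a constant
  have hconst : ∑ _p : (Fin S.n → ZMod S.Q) × ZMod S.Q × (Fin S.n → ZMod S.Q),
      (pairsCountT (S.Q : ℕ) T : ℝ) / ((S.Q : ℕ) : ℝ) ^ (2 * S.n) * n₀
      = ((S.Q : ℕ) : ℝ) * (pairsCountT (S.Q : ℕ) T : ℝ) * n₀ := by
    rw [Finset.sum_const, Finset.card_univ, Fintype.card_prod, Fintype.card_prod, ZMod.card, Fintype.card_pi,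
      Finset.prod_const, Finset.card_univ, Fintype.card_fin, ZMod.card, nsmul_eq_mul]
    push_cast
    have hQ0 : ((S.Q : ℕ) : ℝ) ≠ 0 := hQpos.ne'
    field_simp
    ring
  -- pigeonhole
  obtain ⟨⟨β, x, yb⟩, -, hle⟩ := Finset.exists_le_of_sum_le Finset.univ_nonempty
    (htot.trans (le_of_eq hconst.symm))
  refine ⟨S.famBT T β, S.vOf (S.xyv x yb), S.inClass_famT h T hU β _, ?_⟩
  rw [hlabel, hnorm]
  exact hle


/-- The norm `⟨φ7.d|φ7.d⟩` of an admissible instance is non-negative (indeed `(MD)^{n+1}P2ⁿ`).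
[cite: ChenQuantumLattice2024, §3.5.8 p. 34] -/
theorem star_phi7d_dotProduct_phi7d_inst_nonneg (b₂ v₂ : Fin (S.n + 1) → ℤ) :
    0 ≤ (star (S.inst b₂ v₂).phi7d ⬝ᵥ (S.inst b₂ v₂).phi7d).re :=
  star_dotProduct_self_re_nonneg _

/-- **UPPER SIDE, order form**: with `#T` unknown tail slopes, some instance of the class has success weight
`≤ (1/Q + (1 − 1/Q)·((Q − φ(Q))/Q)^{#T})·⟨φ7.d|φ7.d⟩` — blind guessing (`1/Q`, `blindGuess_weight_eq`) is
optimal up to a term decaying geometrically in the number of unknown slopes.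
[cite: ChenQuantumLattice2024, §3.5.8 pp. 33–34, §3.5.9 p. 37; NielsenChuang2010, §2.2.6 p. 90] -/
theorem step9Needs_readout_le_dummies' (h : S.Admissible) (T : Finset (Fin S.n))
    {U : Finset (Fin (S.n + 1))} (hU : ∀ t ∈ T, t.succ ∈ U) {κ : Type*} [Fintype κ] [DecidableEq κ]
    (E : POVM (Fin (S.n + 1) → ZMod S.M) κ) (dec : κ → ZMod S.N) :
    ∃ b₂ v₂ : Fin (S.n + 1) → ℤ, S.InClass U b₂ v₂ ∧
      (∑ k ∈ Finset.univ.filter (fun k => dec k = (S.inst b₂ v₂).step9Needs),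
          (E.weight (S.inst b₂ v₂).phi7d k).re)
        ≤ (1 / ((S.Q : ℕ) : ℝ) + (1 - 1 / ((S.Q : ℕ) : ℝ))
              * ((((S.Q : ℕ) - (S.Q : ℕ).totient : ℕ) : ℝ) / ((S.Q : ℕ) : ℝ)) ^ T.card)
            * (star (S.inst b₂ v₂).phi7d ⬝ᵥ (S.inst b₂ v₂).phi7d).re := by
  obtain ⟨b₂, v₂, hcl, hle⟩ := S.step9Needs_readout_le_dummies h T hU E dec
  refine ⟨b₂, v₂, hcl, hle.trans (mul_le_mul_of_nonneg_right ?_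
    (S.star_phi7d_dotProduct_phi7d_inst_nonneg b₂ v₂))⟩
  have h1 := pairsCountT_div_le (S.Q : ℕ) T
  rwa [nonGenericCount_div_eq] at h1

/-- **UPPER SIDE, prime `Q`**: `≤ (1/Q + (1 − 1/Q)/Q^{#T})·⟨φ7.d|φ7.d⟩`.
[cite: ChenQuantumLattice2024, §3.5.8 pp. 33–34, §3.5.9 p. 37; NielsenChuang2010, §2.2.6 p. 90] -/
theorem step9Needs_readout_le_dummies_prime (h : S.Admissible) (hQ : (S.Q : ℕ).Prime) (T : Finset (Fin S.n))
    {U : Finset (Fin (S.n + 1))} (hU : ∀ t ∈ T, t.succ ∈ U) {κ : Type*} [Fintype κ] [DecidableEq κ]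
    (E : POVM (Fin (S.n + 1) → ZMod S.M) κ) (dec : κ → ZMod S.N) :
    ∃ b₂ v₂ : Fin (S.n + 1) → ℤ, S.InClass U b₂ v₂ ∧
      (∑ k ∈ Finset.univ.filter (fun k => dec k = (S.inst b₂ v₂).step9Needs),
          (E.weight (S.inst b₂ v₂).phi7d k).re)
        ≤ (1 / ((S.Q : ℕ) : ℝ) + (1 - 1 / ((S.Q : ℕ) : ℝ)) * (1 / ((S.Q : ℕ) : ℝ) ^ T.card))
            * (star (S.inst b₂ v₂).phi7d ⬝ᵥ (S.inst b₂ v₂).phi7d).re := by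
  haveI : Fact (S.Q : ℕ).Prime := ⟨hQ⟩
  obtain ⟨b₂, v₂, hcl, hle⟩ := S.step9Needs_readout_le_dummies h T hU E dec
  refine ⟨b₂, v₂, hcl, hle.trans (mul_le_mul_of_nonneg_right ?_
    (S.star_phi7d_dotProduct_phi7d_inst_nonneg b₂ v₂))⟩
  have h1 := pairsCountT_div_le (S.Q : ℕ) T
  rwa [nonGenericCount_div_eq_prime] at h1

/-- **UPPER SIDE over ALL admissible instances** (every tail slope unknown, as in eq. (12): `b` IS the LWE
secret and error): for every POVM and decoder some admissible instance with the same public data has success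
weight `≤ (1/Q + (1 − 1/Q)·((Q − φ(Q))/Q)ⁿ)·⟨φ7.d|φ7.d⟩`.
[cite: ChenQuantumLattice2024, eq. (12) p. 17, §3.5.8 pp. 33–34, §3.5.9 p. 37] -/
theorem step9Needs_readout_le_all (h : S.Admissible) {κ : Type*} [Fintype κ] [DecidableEq κ]
    (E : POVM (Fin (S.n + 1) → ZMod S.M) κ) (dec : κ → ZMod S.N) :
    ∃ b₂ v₂ : Fin (S.n + 1) → ℤ, (S.inst b₂ v₂).Admissible ∧
      (∑ k ∈ Finset.univ.filter (fun k => dec k = (S.inst b₂ v₂).step9Needs),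
          (E.weight (S.inst b₂ v₂).phi7d k).re)
        ≤ (1 / ((S.Q : ℕ) : ℝ) + (1 - 1 / ((S.Q : ℕ) : ℝ))
              * ((((S.Q : ℕ) - (S.Q : ℕ).totient : ℕ) : ℝ) / ((S.Q : ℕ) : ℝ)) ^ S.n)
            * (star (S.inst b₂ v₂).phi7d ⬝ᵥ (S.inst b₂ v₂).phi7d).re := by
  obtain ⟨b₂, v₂, hcl, hle⟩ := S.step9Needs_readout_le_dummies' h Finset.univ (U := Finset.univ)
    (fun t _ => Finset.mem_univ _) E dec
  refine ⟨b₂, v₂, hcl.2, ?_⟩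
  rwa [Finset.card_univ, Fintype.card_fin] at hle

/-- **THE ORDER OF THE READ-OUT PROBABILITY (both sides).**  For an admissible shape: (i) the blind guess
(read `w₀`, toss a `Q`-sided coin) outputs the Step-9 datum with weight EXACTLY `⟨φ7.d|φ7.d⟩/Q` on every
admissible instance; (ii) NO measurement + decoder does better than
`(1/Q + (1 − 1/Q)·((Q − φ(Q))/Q)ⁿ)·⟨φ7.d|φ7.d⟩` on every admissible instance.  So the worst-case optimum is
`1/Q` up to a geometrically small term: one copy of the Step-8 register tells essentially NOTHING about the
missing residue `v′₀ mod Q` beyond chance.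
[cite: ChenQuantumLattice2024, Claim 3.14 p. 33, §3.5.8 pp. 33–34, §3.5.9 p. 37; NielsenChuang2010, §2.2.6 p. 90] -/
theorem step9Needs_readout_order (h : S.Admissible) :
    (∀ b₂ v₂ : Fin (S.n + 1) → ℤ, (S.inst b₂ v₂).Admissible →
      ∑ k ∈ Finset.univ.filter (fun k => S.blindDec k = (S.inst b₂ v₂).step9Needs),
          (((POVM.readout fun w : Fin (S.n + 1) → ZMod S.M => w 0).withCoin (ZMod S.Q)).weight
            (S.inst b₂ v₂).phi7d k).re
        = (1 / ((S.Q : ℕ) : ℝ)) * (star (S.inst b₂ v₂).phi7d ⬝ᵥ (S.inst b₂ v₂).phi7d).re) ∧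
    (∀ {κ : Type*} [Fintype κ] [DecidableEq κ] (E : POVM (Fin (S.n + 1) → ZMod S.M) κ) (dec : κ → ZMod S.N),
      ∃ b₂ v₂ : Fin (S.n + 1) → ℤ, (S.inst b₂ v₂).Admissible ∧
        (∑ k ∈ Finset.univ.filter (fun k => dec k = (S.inst b₂ v₂).step9Needs),
            (E.weight (S.inst b₂ v₂).phi7d k).re)
          ≤ (1 / ((S.Q : ℕ) : ℝ) + (1 - 1 / ((S.Q : ℕ) : ℝ))
                * ((((S.Q : ℕ) - (S.Q : ℕ).totient : ℕ) : ℝ) / ((S.Q : ℕ) : ℝ)) ^ S.n)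
              * (star (S.inst b₂ v₂).phi7d ⬝ᵥ (S.inst b₂ v₂).phi7d).re) :=
  ⟨fun _ _ hI => S.blindGuess_weight_eq_inst hI, fun E dec => S.step9Needs_readout_le_all h E dec⟩

/-- **No general measurement + decoder outputs `v′₀ mod D²P` from `|φ7.d⟩` with confidence noticeably above
`1/Q`.**  For every admissible shape, every POVM on the Step-8 register valued in `ℤ_{D²P}` and every
`ε < 1 − (1/Q + (1 − 1/Q)·((Q − φ(Q))/Q)ⁿ)`, some admissible instance has
`weight(v′₀ mod D²P) < (1−ε)·⟨φ7.d|φ7.d⟩` — (R)'s hypothesis `ε < 1 − pairsCount(Q)/Q²` relaxed to the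
order-sharp one. [cite: ChenQuantumLattice2024, §3.5.8 p. 34, §3.5.9 p. 37] -/
theorem step9Needs_not_almostCertain_of_lt_order (h : S.Admissible)
    (E : POVM (Fin (S.n + 1) → ZMod S.M) (ZMod S.N)) {ε : ℝ}
    (hε : ε < 1 - (1 / ((S.Q : ℕ) : ℝ) + (1 - 1 / ((S.Q : ℕ) : ℝ))
              * ((((S.Q : ℕ) - (S.Q : ℕ).totient : ℕ) : ℝ) / ((S.Q : ℕ) : ℝ)) ^ S.n)) :
    ¬ ∀ b₂ v₂ : Fin (S.n + 1) → ℤ, (S.inst b₂ v₂).Admissible →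
        E.AlmostCertain ε (S.inst b₂ v₂).phi7d (S.inst b₂ v₂).step9Needs := by
  intro hall
  obtain ⟨b₂, v₂, hI, hle⟩ := S.step9Needs_readout_le_all h E id
  have hw := hall b₂ v₂ hI
  unfold POVM.AlmostCertain at hw
  have hmem : (S.inst b₂ v₂).step9Needs
      ∈ Finset.univ.filter (fun k : ZMod S.N => id k = (S.inst b₂ v₂).step9Needs) :=
    Finset.mem_filter.2 ⟨Finset.mem_univ _, rfl⟩
  have hle' := le_trans (Finset.single_le_sum (f := fun k => (E.weight (S.inst b₂ v₂).phi7d k).re)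
    (fun k _ => E.weight_re_nonneg _ k) hmem) hle
  have hpos : 0 < (star (S.inst b₂ v₂).phi7d ⬝ᵥ (S.inst b₂ v₂).phi7d).re := by
    rw [S.star_phi7d_dotProduct_phi7d_inst hI]
    have hc : (((S.M : ℕ) : ℂ) * (S.D : ℕ)) ^ (S.n + 1) * (((S.P : ℕ) : ℂ) * 2 ^ S.n)
        = ((((((S.M : ℕ) : ℝ) * (S.D : ℕ)) ^ (S.n + 1) * (((S.P : ℕ) : ℝ) * 2 ^ S.n) : ℝ)) : ℂ) := by
      push_cast; ring
    rw [hc, Complex.ofReal_re]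
    have hM : (0 : ℝ) < (S.M : ℕ) := by exact_mod_cast S.M.pos
    have hD : (0 : ℝ) < (S.D : ℕ) := by exact_mod_cast S.D.pos
    have hP : (0 : ℝ) < (S.P : ℕ) := by exact_mod_cast S.P.pos
    positivity
  have h1 := le_of_mul_le_mul_right (hw.trans hle') hpos
  linarith

end Shape

end Literature.Computability.Cryptography.Chen2024
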